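import Literature.NumberTheory.Sieve.SmoothTernaryHolder
import Literature.NumberTheory.Sieve.SmoothTernaryCircle
import HarnessLib

/-!
# A crude upper bound for the number of friable solutions of `d₁n₁ ± d₂n₂ = n₃` in boxes

Topic `Literature/NumberTheory/Sieve`; a PROVED tool file.  The crude (upper-bound only) form of the
circle method of [Harper2016, §5] for the NUMBER of solutions of a ternary linear equation
`d₁n₁ + σd₂n₂ = n₃` (`σ = ±1`, natural dilations `d₁, d₂`) in `y`-friable integers
`n_i ∈ S(x_i, y) = Nat.smoothNumbersUpTo ⌊x_i⌋₊ (y+1)` at three scales `x₁, x₂, x₃`: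

* `card_ternaryFilter_eq_sum` — the solution count (the cardinality of the filtered triple box) as the
  triple sum of indicators that the circle identity evaluates;
* `card_ternaryFilter_le_card_mul` — the TRIVIAL bound `≤ #S(x₁,y) · #S(x₂,y)` (two of the variables
  determine the third), with `card_smoothNumbersUpTo_le_self : #S(N, k) ≤ N`;
* `ternary_crude_count` — the HÖLDER bound: in Harper's regime at each scale, for `N₀` exceeding
  `d₁x₁ + d₂x₂ + x₃` and coprime to `d₁ d₂`,
  `#{solutions} ≤ C (log x₁ log x₂ log x₃)⁸ (1+N₀/x₁)^{2/5} (1+N₀/x₂)^{2/5} (1+N₀/x₃)^{1/5}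
   𝓟(x₁) 𝓟(x₂) 𝓟(x₃)^{1/2} Ψ(x₃,y)^{1/2} / N₀`, `𝓟(x) = x^{α} ζ(α,y)/√φ₂(α,y)`, `α = α(x,y)` —
  the circle identity on `ℤ/N₀` (`ternary_circle_identity_finset`, all weights `1`), the triangle
  inequality, and `ternary_holder_restriction` (Hölder `(5/2,5/2,5)` + oversampled restriction) with the
  trivial supremum `|V₃| ≤ Ψ(x₃,y)`.

No lower bound / main term here (that is the major-arc analysis); this file is the input of tail
estimates where only the order of magnitude `≈ Ψ³/x` with the saving of a shrunken box matters.

## References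

* A. J. Harper, *Minor arcs, mean values, and restriction theory for exponential sums over smooth
  numbers*, Compositio Math. 152 (2016) 1121–1158, Theorem 2 and §5 [Harper2016].
-/

noncomputable section

open Finset Real
open scoped FourierTransform ComplexConjugate

namespace Literature.NumberTheory.Sieve

namespace TernaryCrudeCount

/-! ### The solution count as a triple sum, and the trivial bound -/

/-- The number of triples `(n₁, n₂, n₃) ∈ S₁ × S₂ × S₃` with `d₁n₁ + σd₂n₂ = n₃` is the triple sum of
the indicators of the equation. [folklore] -/
theorem card_ternaryFilter_eq_sum (S₁ S₂ S₃ : Finset ℕ) (d₁ d₂ : ℕ) (σ : ℤ) :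
    (#((S₁ ×ˢ S₂ ×ˢ S₃).filter
        (fun t : ℕ × ℕ × ℕ => (d₁ * t.1 : ℤ) + σ * (d₂ * t.2.1) = t.2.2)) : ℕ) =
      ∑ n₁ ∈ S₁, ∑ n₂ ∈ S₂, ∑ n₃ ∈ S₃,
        if (d₁ * n₁ : ℤ) + σ * (d₂ * n₂) = n₃ then 1 else 0 := by
  rw [Finset.card_filter, Finset.sum_product]
  refine Finset.sum_congr rfl fun n₁ _ => ?_
  rw [Finset.sum_product]

/-- `#S(N, k) ≤ N`: the `k`-smooth numbers up to `N` are among `1, …, N`. [folklore] -/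
theorem card_smoothNumbersUpTo_le_self (N k : ℕ) : #(Nat.smoothNumbersUpTo N k) ≤ N := by
  calc #(Nat.smoothNumbersUpTo N k) ≤ #(Finset.Icc 1 N) := by
        refine Finset.card_le_card fun n hn => ?_
        obtain ⟨hnN, hns⟩ := Nat.mem_smoothNumbersUpTo.1 hn
        exact Finset.mem_Icc.2 ⟨Nat.pos_of_ne_zero (Nat.ne_zero_of_mem_smoothNumbers hns), hnN⟩
    _ = N := by simp

/-- **Trivial bound**: the number of solutions of `d₁n₁ + σd₂n₂ = n₃` in `S₁ × S₂ × S₃` is at most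
`#S₁ · #S₂` (the first two coordinates determine the third). [folklore] -/
theorem card_ternaryFilter_le_card_mul (S₁ S₂ S₃ : Finset ℕ) (d₁ d₂ : ℕ) (σ : ℤ) :
    #((S₁ ×ˢ S₂ ×ˢ S₃).filter
        (fun t : ℕ × ℕ × ℕ => (d₁ * t.1 : ℤ) + σ * (d₂ * t.2.1) = t.2.2)) ≤ #S₁ * #S₂ := by
  rw [← Finset.card_product]
  refine Finset.card_le_card_of_injOn (fun t => (t.1, t.2.1)) (fun t ht => ?_) fun t ht t' ht' h => ?_
  · rw [Finset.coe_filter] at ht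
    obtain ⟨hmem, -⟩ := ht
    rw [Finset.mem_product, Finset.mem_product] at hmem
    exact Finset.mem_coe.2 (Finset.mem_product.2 ⟨hmem.1, hmem.2.1⟩)
  · rw [Finset.coe_filter] at ht ht'
    obtain ⟨-, heq⟩ := ht
    obtain ⟨-, heq'⟩ := ht'
    simp only [Prod.mk.injEq] at h
    obtain ⟨h1, h2⟩ := h
    have h3 : (t.2.2 : ℤ) = t'.2.2 := by rw [← heq, ← heq', h1, h2]
    exact Prod.ext h1 (Prod.ext h2 (by exact_mod_cast h3))

/-! ### Norms of unweighted exponential sums -/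

/-- `‖Σ_{n ∈ S} 1 · e(nθ)‖ ≤ #S`. [folklore] -/
theorem norm_sum_one_mul_fourierChar_le (S : Finset ℕ) (θ : ℕ → ℝ) :
    ‖∑ n ∈ S, (1 : ℂ) * (𝐞 (θ n) : ℂ)‖ ≤ (#S : ℝ) := by
  calc ‖∑ n ∈ S, (1 : ℂ) * (𝐞 (θ n) : ℂ)‖ ≤ ∑ n ∈ S, ‖(1 : ℂ) * (𝐞 (θ n) : ℂ)‖ := norm_sum_le _ _
    _ = ∑ n ∈ S, (1 : ℝ) := Finset.sum_congr rfl fun n _ => by rw [one_mul, Circle.norm_coe]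
    _ = #S := by simp

/-- From the circle identity `Σ_r A_r B_r conj C_r = N · c` and a bound for `Σ_r ‖A_r‖ ‖B_r‖ ‖C_r‖`,
the bound `N · c ≤ bound` (triangle inequality, `‖conj z‖ = ‖z‖`). [folklore] -/
theorem natMul_le_of_circle {ι : Type*} (s : Finset ι) (A B C : ι → ℂ) {N c : ℕ} {bound : ℝ}
    (hid : ∑ r ∈ s, A r * B r * conj (C r) = (N : ℂ) * (c : ℂ))
    (hB : ∑ r ∈ s, ‖A r‖ * ‖B r‖ * ‖C r‖ ≤ bound) : (N : ℝ) * c ≤ bound := by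
  have h : ‖(N : ℂ) * (c : ℂ)‖ = (N : ℝ) * c := by
    rw [norm_mul, Complex.norm_natCast, Complex.norm_natCast]
  rw [← h, ← hid]
  exact (norm_sum_le _ _).trans ((Finset.sum_le_sum fun r _ => by
    rw [norm_mul, norm_mul, Complex.norm_conj]).trans hB)

end TernaryCrudeCount

open TernaryCrudeCount

/-- **Crude Hölder bound for friable solutions of `d₁n₁ + σd₂n₂ = n₃` in boxes.**  With
`S(x, y) = Nat.smoothNumbersUpTo ⌊x⌋₊ (y+1)`, `Ψ(x, y) = #S(x, y)` and
`𝓟(x) = x^{α} ζ(α,y)/√φ₂(α,y)` (`α = α(x,y)`): in Harper's regime at each of the three scales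
(`x_i ≥ x₀`, `(log x_i)⁸ ≤ y`, `log y ≤ ½ (log x_i)^{1/6}`, `y^{200} ≤ x_i`, `α(x_i,y) ≥ 1 − 10⁻⁴`,
`Ψ(x_i,y) ≥ x_i^{39999/40000}`), for natural dilations `d₁, d₂` coprime to `N₀`, a sign `σ = ±1`, and
`d₁⌊x₁⌋ + d₂⌊x₂⌋ + ⌊x₃⌋ < N₀` (no wrap-around), the number of `(n₁, n₂, n₃) ∈ S(x₁,y) × S(x₂,y) × S(x₃,y)`
with `d₁n₁ + σd₂n₂ = n₃` is at most
`C (log x₁ log x₂ log x₃)⁸ (1+N₀/x₁)^{2/5} (1+N₀/x₂)^{2/5} (1+N₀/x₃)^{1/5} 𝓟(x₁) 𝓟(x₂) 𝓟(x₃)^{1/2} Ψ(x₃,y)^{1/2} / N₀`.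
Proof: the count times `N₀` is `Σ_{r<N₀} V₁(d₁r/N₀) V₂(σd₂r/N₀) conj V₃(r/N₀)` (circle identity with unit
weights), bounded through the triangle inequality by `ternary_holder_restriction` with the trivial
supremum `|V₃| ≤ Ψ(x₃,y)`. [cite: Harper2016, Theorem 2 and §5] -/
theorem ternary_crude_count :
    ∃ C x₀ : ℝ, 0 < C ∧ ∀ (y : ℕ) (x₁ x₂ x₃ : ℝ),
      x₀ ≤ x₁ → Real.log x₁ ^ 8 ≤ (y : ℝ) → Real.log (y : ℝ) ≤ 1 / 2 * Real.log x₁ ^ (1 / 6 : ℝ) →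
      (y : ℝ) ^ 200 ≤ x₁ → 1 - 1 / 10000 ≤ saddlePoint x₁ y →
      x₁ ^ ((39999 : ℝ) / 40000) ≤ ((Nat.smoothNumbersUpTo ⌊x₁⌋₊ (y + 1)).card : ℝ) →
      x₀ ≤ x₂ → Real.log x₂ ^ 8 ≤ (y : ℝ) → Real.log (y : ℝ) ≤ 1 / 2 * Real.log x₂ ^ (1 / 6 : ℝ) →
      (y : ℝ) ^ 200 ≤ x₂ → 1 - 1 / 10000 ≤ saddlePoint x₂ y →
      x₂ ^ ((39999 : ℝ) / 40000) ≤ ((Nat.smoothNumbersUpTo ⌊x₂⌋₊ (y + 1)).card : ℝ) →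
      x₀ ≤ x₃ → Real.log x₃ ^ 8 ≤ (y : ℝ) → Real.log (y : ℝ) ≤ 1 / 2 * Real.log x₃ ^ (1 / 6 : ℝ) →
      (y : ℝ) ^ 200 ≤ x₃ → 1 - 1 / 10000 ≤ saddlePoint x₃ y →
      x₃ ^ ((39999 : ℝ) / 40000) ≤ ((Nat.smoothNumbersUpTo ⌊x₃⌋₊ (y + 1)).card : ℝ) →
      ∀ (N₀ d₁ d₂ : ℕ), Nat.Coprime d₁ N₀ → Nat.Coprime d₂ N₀ → ∀ σ : ℤ, (σ = 1 ∨ σ = -1) →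
      d₁ * ⌊x₁⌋₊ + d₂ * ⌊x₂⌋₊ + ⌊x₃⌋₊ < N₀ →
        (#((Nat.smoothNumbersUpTo ⌊x₁⌋₊ (y + 1) ×ˢ Nat.smoothNumbersUpTo ⌊x₂⌋₊ (y + 1) ×ˢ
              Nat.smoothNumbersUpTo ⌊x₃⌋₊ (y + 1)).filter
            (fun t : ℕ × ℕ × ℕ => (d₁ * t.1 : ℤ) + σ * (d₂ * t.2.1) = t.2.2)) : ℝ) ≤
        C * (Real.log x₁ * Real.log x₂ * Real.log x₃) ^ (8 : ℕ) *
          (1 + (N₀ : ℝ) / x₁) ^ (2 / 5 : ℝ) * (1 + (N₀ : ℝ) / x₂) ^ (2 / 5 : ℝ) *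
          (1 + (N₀ : ℝ) / x₃) ^ (1 / 5 : ℝ) *
          (x₁ ^ saddlePoint x₁ y *
            (smoothZeta (saddlePoint x₁ y) y / Real.sqrt (saddlePhi₂ (saddlePoint x₁ y) y))) *
          (x₂ ^ saddlePoint x₂ y *
            (smoothZeta (saddlePoint x₂ y) y / Real.sqrt (saddlePhi₂ (saddlePoint x₂ y) y))) *
          (x₃ ^ saddlePoint x₃ y *
            (smoothZeta (saddlePoint x₃ y) y / Real.sqrt (saddlePhi₂ (saddlePoint x₃ y) y))) ^
              (1 / 2 : ℝ) *
          ((Nat.smoothNumbersUpTo ⌊x₃⌋₊ (y + 1)).card : ℝ) ^ (1 / 2 : ℝ) / N₀ := by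
  obtain ⟨C, x₀, hC, hH⟩ := ternary_holder_restriction
  refine ⟨C, x₀, hC, ?_⟩
  intro y x₁ x₂ x₃ hx₁ hy8₁ hy6₁ hy200₁ hα₁ hΨ₁ hx₂ hy8₂ hy6₂ hy200₂ hα₂ hΨ₂ hx₃ hy8₃ hy6₃ hy200₃ hα₃ hΨ₃
    N₀ d₁ d₂ hd₁ hd₂ σ hσ hwrap
  set S₁ : Finset ℕ := Nat.smoothNumbersUpTo ⌊x₁⌋₊ (y + 1) with hS₁
  set S₂ : Finset ℕ := Nat.smoothNumbersUpTo ⌊x₂⌋₊ (y + 1) with hS₂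
  set S₃ : Finset ℕ := Nat.smoothNumbersUpTo ⌊x₃⌋₊ (y + 1) with hS₃
  have hN₀ : N₀ ≠ 0 := by omega
  have hN₀1 : 1 ≤ N₀ := Nat.one_le_iff_ne_zero.2 hN₀
  have hN₀r : (0 : ℝ) < N₀ := by exact_mod_cast hN₀1
  -- the count as a triple sum of indicators, cast to `ℂ`
  set cnt : ℕ := #((S₁ ×ˢ S₂ ×ˢ S₃).filter
      (fun t : ℕ × ℕ × ℕ => (d₁ * t.1 : ℤ) + σ * (d₂ * t.2.1) = t.2.2)) with hcnt
  have hcntC : (cnt : ℂ) = ∑ n₁ ∈ S₁, ∑ n₂ ∈ S₂, ∑ n₃ ∈ S₃,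
      if (d₁ * n₁ : ℤ) + σ * (d₂ * n₂) = (1 : ℕ) * n₃ then
        (1 : ℂ) * 1 * conj (1 : ℂ) else 0 := by
    rw [hcnt, card_ternaryFilter_eq_sum]
    push_cast
    refine Finset.sum_congr rfl fun n₁ _ => Finset.sum_congr rfl fun n₂ _ =>
      Finset.sum_congr rfl fun n₃ _ => ?_
    simp only [map_one, mul_one, one_mul]
  -- the circle identity with unit weights, no shift, `d₃ = 1`
  have hmem : ∀ {x : ℝ} {n : ℕ}, n ∈ Nat.smoothNumbersUpTo ⌊x⌋₊ (y + 1) → n ≤ ⌊x⌋₊ :=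
    fun h => (Nat.mem_smoothNumbersUpTo.1 h).1
  have hwrap' : d₁ * ⌊x₁⌋₊ + d₂ * ⌊x₂⌋₊ + 1 * ⌊x₃⌋₊ < N₀ := by simpa using hwrap
  have hcircle := ternary_circle_identity_finset hN₀ (S₁ := S₁) (S₂ := S₂) (S₃ := S₃)
    (fun n hn => hmem hn) (fun n hn => hmem hn) (fun n hn => hmem hn) d₁ d₂ 1 σ hσ hwrap'
    (fun _ => (1 : ℂ)) (fun _ => (1 : ℂ)) (fun _ => (1 : ℂ)) 0
  rw [← hcntC] at hcircle
  -- the three exponential sums in the form of `ternary_holder_restriction`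
  have hV₁ : ∀ r : ℕ, (∑ n ∈ S₁, (1 : ℂ) * (𝐞 ((n : ℝ) * ((d₁ : ℝ) * ((r : ℝ) / N₀ + 0))) : ℂ)) =
      ∑ n ∈ S₁, (1 : ℂ) * (𝐞 ((n : ℝ) * (((d₁ : ℤ) * r : ℝ) / N₀)) : ℂ) := fun r =>
    Finset.sum_congr rfl fun n _ => by
      rw [show (n : ℝ) * ((d₁ : ℝ) * ((r : ℝ) / N₀ + 0)) = (n : ℝ) * (((d₁ : ℤ) * r : ℝ) / N₀) by
        push_cast; ring]
  have hV₂ : ∀ r : ℕ, (∑ n ∈ S₂, (1 : ℂ) * (𝐞 ((n : ℝ) * ((σ * d₂ : ℝ) * ((r : ℝ) / N₀ + 0))) : ℂ)) =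
      ∑ n ∈ S₂, (1 : ℂ) * (𝐞 ((n : ℝ) * (((σ * (d₂ : ℤ) : ℤ) * r : ℝ) / N₀)) : ℂ) := fun r =>
    Finset.sum_congr rfl fun n _ => by
      rw [show (n : ℝ) * ((σ * d₂ : ℝ) * ((r : ℝ) / N₀ + 0)) =
          (n : ℝ) * (((σ * (d₂ : ℤ) : ℤ) * r : ℝ) / N₀) by push_cast; ring]
  have hV₃ : ∀ r : ℕ, (∑ n ∈ S₃, (1 : ℂ) * (𝐞 ((n : ℝ) * (((1 : ℕ) : ℝ) * ((r : ℝ) / N₀ + 0))) : ℂ)) =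
      ∑ n ∈ S₃, (1 : ℂ) * (𝐞 ((n : ℝ) * (((1 : ℤ) * r : ℝ) / N₀)) : ℂ) := fun r =>
    Finset.sum_congr rfl fun n _ => by
      rw [show (n : ℝ) * (((1 : ℕ) : ℝ) * ((r : ℝ) / N₀ + 0)) = (n : ℝ) * (((1 : ℤ) * r : ℝ) / N₀) by
        push_cast; ring]
  simp only [hV₁, hV₂, hV₃] at hcircle
  -- coprimality of the integer dilations
  have hd₁' : IsCoprime (d₁ : ℤ) (N₀ : ℤ) := Nat.isCoprime_iff_coprime.2 hd₁
  have hσ' : IsCoprime σ (N₀ : ℤ) := by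
    rcases hσ with rfl | rfl
    · exact isCoprime_one_left
    · exact isCoprime_one_left.neg_left
  have hd₂' : IsCoprime (σ * (d₂ : ℤ)) (N₀ : ℤ) := hσ'.mul_left (Nat.isCoprime_iff_coprime.2 hd₂)
  have hd₃' : IsCoprime (1 : ℤ) (N₀ : ℤ) := isCoprime_one_left
  -- Hölder–restriction with unit coefficients and the trivial supremum `Ψ(x₃, y)`
  have hone : ∀ n : ℕ, ‖(fun _ : ℕ => (1 : ℂ)) n‖ ≤ 1 := fun n => by simp
  have hB := hH y x₁ x₂ x₃ hx₁ hy8₁ hy6₁ hy200₁ hα₁ hΨ₁ hx₂ hy8₂ hy6₂ hy200₂ hα₂ hΨ₂ hx₃ hy8₃ hy6₃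
    hy200₃ hα₃ hΨ₃ N₀ hN₀1 (d₁ : ℤ) (σ * (d₂ : ℤ)) 1 hd₁' hd₂' hd₃' (fun _ => 1) (fun _ => 1)
    (fun _ => 1) hone hone hone (Finset.range N₀) subset_rfl (#S₃ : ℝ) (Nat.cast_nonneg _)
    (fun r _ => norm_sum_one_mul_fourierChar_le S₃ _)
  -- `N₀ · cnt ≤` the Hölder bound
  have hle := natMul_le_of_circle _ _ _ _ hcircle hB
  rw [le_div_iff₀ hN₀r, mul_comm]
  exact hle

end Literature.NumberTheory.Sieve

end
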